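import Summits.BirchSwinnertonDyer.BirchSwinnertonDyer.Theorems.PrintCFramAcDescentThreeOrbitAll
import HarnessLib

/-!
# (A𝒪)ᴳʳ — the regime-free `Λ^ac`-level elliptic-unit main conjecture at the ramified `3` over the
# `End_K(E_K)`-orbit span, in GREENBERG (Σ-imprimitive-at-the-bad-places) form (cell `bsd-print-cfram`,
# D-0131 (2) PRINT tier, prover seat p2 gen 3; companion of `PrintCFramAcDescentThreeOrbitAll.lean`
# (p572351); a CANDIDATE text for the regime-free IMC item r6′ — planner's / referee's call;
# `--supports stmt-BirchSwinnertonDyer-21353 --as helper`)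

NOTHING is asserted: one definition (a set of places), one `@[conjecture]` `Prop` per curve and its
slice form.

WHY (ty2 g4 RULING 2026-08-27T21:40:30Z (3), p2 CONCUR 21:43:16Z, referee adjudication pending). Every
IMC carrier of the cell at `3` — the bottom-level ones (items 21353/21352, the N ∪ V / ALL carriers) and
the `Λ`-level ones ((A) p566137, (A𝒪) p570848, (A𝒪)ᴬᴸᴸ p572351) — equates the elliptic-unit side with
the characteristic ideal of the MINIMAL strict Selmer dual `X_min = AcSelmer.XAc (W_K) 3 κ 𝔭 ∅ γ`
(locally trivial at every finite `w ∤ 3`). What DESCENDS EXACTLY from the two-variable identity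
(JLK 2011 / Rubin 1991: modules unramified outside `𝔭` over `K(E[𝔭^∞])`, where `E` has good reduction
at every `w ∤ 3`; base change `Λ₂ → Λ^ac` is exact for Galois cohomology with NO local condition at the
bad set) is the Σ-IMPRIMITIVE identity with `X_Σ = AcSelmer.XAc (W_K) 3 κ 𝔭 S_bad γ` (no condition at
the bad places `v ∤ 3` of `W_K`). The two duals have the same characteristic ideal up to the local
terms at the bad places INERT over `ℚ` — these split completely in `K^ac_∞` (`c(v) = v`), and contribute
`Λ ⊗ H¹(K_v, E[3^∞])^∨` of characteristic ideal `(3)^{t(v)}`, `t(v) = log₃ #E_K(K_v)[3^∞] =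
ord₃ c_v(E_K)` (`= 1` exactly at Kodaira type IV/IV* of an inert `ℓ`; ty2 census kit j291137: 44/100
window classes) — the minimal/Greenberg `μ`-dichotomy of Pollack–Weston 2011 (Compositio 147, §3:
Remark 3.1, Lemma 3.4, Prop. 3.7, Thm. 1.1 `μ^an = Σ_{q ∣ N⁻} t(q)`). Since `L(ψ_E, s)` has Euler factor
`1` at additive primes, the elliptic-unit side cannot absorb the factor; so the `Λ`-level identity in
its BSD-consistent form is `char_Λ(𝒮^ac_rel ⧸ Λ_𝒪·z^ac) = char_Λ(X_Σ) (= char_Λ(X_min)·(3)^{t_cs})`,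
`t_cs = Σ_{inert bad v} ord₃ c_v(E_K)`. At `p ≥ 5` every additive `c_v ≤ 4`, `t ≡ 0`, and the two forms
agree ([BKNO]'s printed minimal `X_str` is right there; the cell's `p ≥ 5` statements are unaffected).

* `badPlacesAwayThree W K` — the finite places `v ∤ 3` of `K` at which `W_K` has bad reduction (the
  imprimitivity set; taking ALL bad places rather than only the inert ones changes `X` by a
  pseudo-null module at the finitely decomposed ones, so the characteristic ideal is that of ty2's
  `S_cs`-form).
* `AcMainConjectureOrbitGrAtZpThree W` — (A𝒪)ᴳʳ: p572351's (A𝒪)ᴬᴸᴸ VERBATIM with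
  `XAc (W_K) 3 κ 𝔭 ∅ γ` replaced by `XAc (W_K) 3 κ 𝔭 (badPlacesAwayThree W K) γ` in both the torsion
  and the characteristic-ideal clause. Regime-free, `Λ`-level (no bottom layer). `@[conjecture]`.
* `AcMainConjectureOrbitGrThree` — slice form (binders of the route's `p = 3` items).

NO join to item 21353 as filed is offered: its bottom-level body «`n₀ + log₃ #X_min[T] = c`» is short by
`t_cs` on the `t_cs > 0` classes of regime N (ty2 (3)/(5)); the bottom reading of (A𝒪)ᴳʳ belongs with the
REPAIRED item text (planner, REPAIR DUTY) and with the descent obligation «`char X_Σ = char X_min ·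
(3)^{t_cs}`» (Poitou–Tate + the local computation above — algebra, provable in principle; to be typed
over ty2's `inertTamagawaProductThree` once that definition is in the tree). HONEST LIMITS: nothing
asserted; referee adjudication of ty2 (3) pending at the time of writing — if the referee rules for the
minimal form, p572351's (A𝒪)ᴬᴸᴸ is the text and this file is moot. «beyond-print theorem»: NO.

References: [PollackWeston2011] R. Pollack, T. Weston, *On anticyclotomic μ-invariants of modular
forms*, Compositio Math. 147 (2011), §3 (Remark 3.1, Lemma 3.4, Prop. 3.7), Thm. 1.1 (held
`paper:arxiv-math_0610694`); [BurungaleKobayashiNakamuraOta2026] arXiv:2608.06879v1 §3.1.2 (the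
minimal `H¹_f` at `v ∤ p`), §3.2.2, Thm. 3.14 (claim; preprint); [JohnsonLeungKings2011] §5.4;
[Rubin1991] §4 (`X_∞` unramified outside `𝔭`); [GreenbergLNM1716] §2 (Σ-imprimitive Selmer groups);
[Castella2018] Def. 2.2 (the carrier `Sel_𝔭^Σ`, `X_ac^Σ`); cell STATUS ty2 g4 21:40:30Z, p2 21:43:16Z.
-/

-- the summit namespace `Summit.BirchSwinnertonDyer.BirchSwinnertonDyer` repeats the problem name by design (D-0017)
set_option linter.dupNamespace false

noncomputable section

open scoped Classical

open WeierstrassCurve NumberField IsDedekindDomain Field Module PowerSeries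
  Literature.NumberTheory.GaloisRepresentations
  Literature.NumberTheory.EllipticCurves
  Literature.NumberTheory.EllipticCurves.Rank1Residual
  Literature.NumberTheory.EllipticCurves.Rank1Residual.Typed
  Literature.NumberTheory.EllipticCurves.Castella2018
  Literature.NumberTheory.EllipticCurves.BurungaleKobayashiNakamuraOta2026
  Literature.NumberTheory.EllipticCurves.KellerYin2024
  Literature.NumberTheory.ComplexMultiplication.EllipticUnits
  Literature.NumberTheory.ComplexMultiplication.EllipticUnits.JohnsonLeungKings2011
  Literature.NumberTheory.NumberFields
  Summit.BirchSwinnertonDyer.Rank1Residual.Additive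
  Summit.BirchSwinnertonDyer.Rank1Residual.X12.O11
  Summit.BirchSwinnertonDyer.BirchSwinnertonDyer.Theorems.PrintCFram.AcDescentThreeSplit

namespace Summit.BirchSwinnertonDyer.BirchSwinnertonDyer.Theorems.PrintCFram.AcDescentThreeOrbit

/-! ## §1 The imprimitivity set: the bad places away from `3` -/

/-- **The bad places of `W_K` away from `3`**: the finite places `v ∤ 3` of `K` at which the base change
`W_K` does NOT have good reduction — the Σ of the Σ-imprimitive (Greenberg) anticyclotomic Selmer dual
`AcSelmer.XAc (W_K) 3 κ 𝔭 Σ γ` (no local condition at `v ∈ Σ`). For a CM curve all these places are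
additive; the ones inert over `ℚ` split completely in `K^ac_∞` and carry the `μ`-type local terms
`(3)^{ord₃ c_v(W_K)}`. [cite: GreenbergLNM1716, §2 (the Σ-imprimitive Selmer group: no condition at the places of Σ)]
[cite: Castella2018, Def. 2.2 (arXiv:1704.06608 p. 5) (the carrier Sel_𝔭^Σ)] -/
def badPlacesAwayThree (W : WeierstrassCurve ℚ) (K : Type) [Field K] [NumberField K] :
    Set (HeightOneSpectrum (𝓞 K)) :=
  {v | ((3 : ℕ) : 𝓞 K) ∉ v.asIdeal ∧ ¬ (W.baseChange K).HasGoodReductionAt v}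

/-- Membership in `badPlacesAwayThree`. [cite: GreenbergLNM1716, §2] -/
theorem mem_badPlacesAwayThree_iff (W : WeierstrassCurve ℚ) (K : Type) [Field K] [NumberField K]
    (v : HeightOneSpectrum (𝓞 K)) :
    v ∈ badPlacesAwayThree W K ↔ ((3 : ℕ) : 𝓞 K) ∉ v.asIdeal ∧ ¬ (W.baseChange K).HasGoodReductionAt v :=
  Iff.rfl

variable (W : WeierstrassCurve ℚ) [W.IsElliptic] [W.IsGloballyMinimal]

/-! ## §2 (A𝒪)ᴳʳ at a curve `W` of the `p = 3` slice -/

/-- **(A𝒪)ᴳʳ — the REGIME-FREE anticyclotomic elliptic-unit MAIN CONJECTURE at `Λ^ac`-level, at the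
ramified `3`, RELATIVE to JLK's two-variable identity for `η_E`, over the orbit span `Λ_𝒪 · z^ac`, in
GREENBERG form** (`@[conjecture]`, NOTHING asserted): p572351's `AcMainConjectureOrbitAllAtZpThree W`
VERBATIM with the minimal dual `XAc (W_K) 3 κ 𝔭 ∅ γ` replaced by the Σ-imprimitive dual
`XAc (W_K) 3 κ 𝔭 (badPlacesAwayThree W K) γ` (no local condition at the bad places `v ∤ 3`) — the form
that descends exactly from the two-variable identity and is BSD-consistent (module docstring;
Pollack–Weston's minimal/Greenberg dichotomy; `= char X_min · (3)^{t_cs}`). PRE `⊗ ℚ₃` on N ∪ V (μ-blind),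
beyond print integrally. OPEN. [cite: PollackWeston2011, §3 Remark 3.1, Lemma 3.4, Prop. 3.7 and Thm. 1.1 (the minimal/Greenberg μ-dichotomy; shape transported to the CM/elliptic-unit setting)]
[cite: BurungaleKobayashiNakamuraOta2026, Prop. 3.7 (2)–(4), Thm. 3.14 (2)/(3) (arXiv:2608.06879v1 pp. 19–24) (claim; preprint; shape only)]
[cite: JohnsonLeungKings2011, §5.4 (arXiv:0804.2828 p0016:L19–26) (the antecedent; shape only)] -/
@[conjecture] def AcMainConjectureOrbitGrAtZpThree : Prop :=
  ∀ (K : Type) [Field K] [NumberField K] (𝔭 : HeightOneSpectrum (𝓞 K))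
    (W' : WeierstrassCurve ℚ) [W'.IsElliptic] [W'.IsGloballyMinimal] (C : VariableChange ℚ),
    IsFrameThree W K 𝔭 W' C → W.analyticRank = 1 →
    NumberField.classNumber K = 1 →
    (∀ w : HeightOneSpectrum (𝓞 K), ((3 : ℕ) : 𝓞 K) ∈ w.asIdeal → w = 𝔭) →
    ∀ (Φ : AddSubgroup (W.baseChange K).geomPoints)
      (η : FramedGaloisRep K (padicCoeffIntegers (∅ : Set (PadicAlgCl 3))) 1),
      Nat.card Φ = 3 → Φ ≤ geomTorsion (W.baseChange K) (3 : ℤ) →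
      (∀ σ : absoluteGaloisGroup K, ∀ P ∈ Φ, σ • P ∈ Φ) →
      IsResidualPairOver (W.baseChange K) 3 η η → IsTeichmullerLiftOn ∅ Φ η →
      (∀ σ : absoluteGaloisGroup K, η σ = 1 ↔ ∀ P ∈ Φ, σ • P = P) →
      (∀ {K₀ : IntermediateField K (AlgebraicClosure K)},
        K₀.fixingSubgroup = (η.toMonoidHom.ker).map (absoluteGaloisGroup.toAlgEquiv K).toMonoidHom →
        ∀ {κ₁ κ₂ : ZpExtension K 3} {γ₁ γ₂ : absoluteGaloisGroup K},
          ZpExtension.IsTopGeneratorPair κ₁ κ₂ γ₁ γ₂ → η γ₁ = 1 → η γ₂ = 1 →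
          ∀ (ι : K →+* ℂ) (D : ClassGroupDualData₂ κ₁ κ₂ η γ₁ γ₂)
            (E : UnitIndexData₂ ι K₀ κ₁ κ₂ η γ₁ γ₂),
            Module.Finite (IwasawaAlgebra₂ 3) D.X ∧ Module.IsTorsion (IwasawaAlgebra₂ 3) D.X ∧
              Module.Finite (IwasawaAlgebra₂ 3) E.Q ∧ Module.IsTorsion (IwasawaAlgebra₂ 3) E.Q ∧
              Module.charIdeal (IwasawaAlgebra₂ 3) D.X = Module.charIdeal (IwasawaAlgebra₂ 3) E.Q) →
      ∀ (κ : ZpExtension K 3), κ.IsAnticyclotomic →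
        ∀ (γ : absoluteGaloisGroup K) [Fact (κ.IsTopGenerator γ)],
          ∃ (ι : PadicAlgCl 3 ≃+* ℂ) (φ : HeckeCharacter K) (Ω : ℂ) (𝓔 : AcDualExpSystem W 3 K 𝔭 κ ι)
            (D : EllipticUnitClassData W 3 K 𝔭 κ γ ι φ Ω 𝓔),
            Ω ≠ 0 ∧ (∀ s : ℂ, 3 / 2 < s.re → heckeLFunction φ s = W.LSeries s) ∧
            ∀ (𝒮 : LambdaAdicRelaxedSelmerData (W.baseChange K) κ γ 𝔭),
              Module.IsTorsion (IwasawaAlgebra 3) (𝒮.S ⧸ endOrbitSpan 𝒮 D.z) ∧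
              Module.IsTorsion (IwasawaAlgebra 3) (AcSelmer.XAc (W.baseChange K) 3 κ 𝔭 (badPlacesAwayThree W K) γ) ∧
              Module.charIdeal (IwasawaAlgebra 3) (𝒮.S ⧸ endOrbitSpan 𝒮 D.z) =
                Module.charIdeal (IwasawaAlgebra 3) (AcSelmer.XAc (W.baseChange K) 3 κ 𝔭 (badPlacesAwayThree W K) γ)


/-! ## §3 Slice form -/

/-- **(A𝒪)ᴳʳ on the whole `p = 3` slice** (binders of the route's `p = 3` items). `@[conjecture]`,
nothing asserted; a candidate text for a regime-free Λ-level IMC item in Greenberg form (planner's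
call, referee adjudication of the X-form pending). [cite: PollackWeston2011, §3 Prop. 3.7 (shape only)] -/
@[conjecture] def AcMainConjectureOrbitGrThree : Prop :=
  ∀ (W : WeierstrassCurve ℚ) [W.IsElliptic] [W.IsGloballyMinimal],
    W.HasCM → CMRamified W 3 → W.analyticRank = 1 → AcMainConjectureOrbitGrAtZpThree W

end Summit.BirchSwinnertonDyer.BirchSwinnertonDyer.Theorems.PrintCFram.AcDescentThreeOrbit

end
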